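import Mathlib

/-!
# Stub `RelVis` (crux `HiddenCornerLemmaR`, stmt-MatrixMultiplication-10752, line `Sketch`)

The relative H-constant lemma ("a visible target forces `r ≤ q`") of the hidden-corner lemma.
Let `Z` be the lower shift on `ℂ^N` (`Z i j = [i = j + 1]`).  Suppose every coefficient matrix
`T a b` of a pencil satisfies the mixed Stein displacement equation
`T a b − Z (T a b) Zᵀ = G₀ * (H₁ a b)ᵀ + G a b * H₀ᵀ` with ONE constant left factor `G₀ : N × p`
whose first `c` rows vanish and ONE constant right factor `H₀ : N × q`, and the pencil hides a
linearly explained corner `(∑ X a b • T a b) * E = F * X` such that some entry of `F` in the first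
`c` rows is nonzero.  Then `r ≤ q` (no rank or nonsingularity hypotheses; `p` plays no role).

Proof (formalised below; it is the proof of the H-const lemma run modulo `X ^ c` instead of
`X ^ N`, after replacing `c` by `min c N`).
* Stein telescoping: `T = ∑_{k<N} Z^k D (Zᵀ)^k + Z^N T (Zᵀ)^N` with `D = G₀ H₁ᵀ + G H₀ᵀ`.
* Corner per coefficient: `X := Matrix.single a b 1` gives `T a b * E = F * single a b 1`.
* Pass to polynomials: a column `v ∈ ℂ^N` becomes `vp v = ∑ C (v l) X^l ∈ ℂ[X]`; then
  `vp (Z * A) ≡ X * vp A (mod X^N)`, `vp (A * S) = ∑ vp (A · a) * C (S a c)`, and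
  `X ^ c ∣ vp (col of G₀)` because the first `c` rows of `G₀` vanish.  Hence the `G₀`-part of the
  telescoped sum disappears modulo `X ^ c` (`c ≤ N`), and for a fixed `a`, with
  `Γ b j = vp (col j of G a b)` (`r × q`) and `Ψ j c' = ∑_k X^k C ((H₀ᵀ (Zᵀ)^k E) j c')` (`q × r`),
  one gets `Γ * Ψ ≡ φ • 1 (mod X^c)` where `φ = vp (col a of F)`.
* Choose `a` with a nonzero entry of `col a of F` above row `c`; write `φ = X^m u`, `u(0) ≠ 0`;
  then `m < c`.  So `Γ * Ψ = X^m • (u • 1 + X^{c-m} • Y)` has determinant `X^{m r} · g` with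
  `g(0) = u(0)^r ≠ 0`, while `det (Γ * Ψ) = 0` if `q < r` (evaluate at every `z : ℂ`: an
  `r × q` times `q × r` product has rank `≤ q < r`).  Contradiction, so `r ≤ q`.
-/

set_option linter.dupNamespace false

namespace Summit.MatrixMultiplication.MatrixMultiplication.Theorems

open Polynomial Matrix

/-- Coefficient extraction: the `i`-th coefficient of `∑ C (A l c) X^l` is `A i c`. -/
private theorem relvis_coeff_vp {N n : ℕ} (A : Matrix (Fin N) (Fin n) ℂ) (c : Fin n) (i : Fin N) :
    (∑ l : Fin N, C (A l c) * X ^ (l : ℕ)).coeff i = A i c := by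
  simp [finsetSum_coeff, Fin.val_inj]

/-- The coefficients of `∑ C (A l c) X^l` vanish from degree `N` on. -/
private theorem relvis_coeff_vp_of_le {N n : ℕ} (A : Matrix (Fin N) (Fin n) ℂ) (c : Fin n)
    {m : ℕ} (hm : N ≤ m) : (∑ l : Fin N, C (A l c) * X ^ (l : ℕ)).coeff m = 0 := by
  simp only [finsetSum_coeff, coeff_C_mul_X_pow]
  refine Finset.sum_eq_zero fun l _ => ?_
  rw [if_neg]
  have := l.is_lt
  omega

/-- If the first `c` rows of `A` vanish then `X ^ c` divides every column polynomial of `A`. -/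
private theorem relvis_vp_dvd_of_rows {N n c : ℕ} (A : Matrix (Fin N) (Fin n) ℂ)
    (hA : ∀ i : Fin N, (i : ℕ) < c → ∀ k, A i k = 0) (k : Fin n) :
    (X : ℂ[X]) ^ c ∣ ∑ l : Fin N, C (A l k) * X ^ (l : ℕ) := by
  rw [X_pow_dvd_iff]
  intro m hm
  rcases lt_or_ge m N with hmN | hmN
  · have h := relvis_coeff_vp A k ⟨m, hmN⟩
    simp only at h
    rw [h]
    exact hA _ hm k
  · exact relvis_coeff_vp_of_le A k hmN

/-- Product rule: the column polynomial of `A * S` is a `C`-linear combination of those of `A`. -/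
private theorem relvis_vp_mul {N n n' : ℕ} (A : Matrix (Fin N) (Fin n) ℂ)
    (S : Matrix (Fin n) (Fin n') ℂ) (c : Fin n') :
    (∑ l : Fin N, C ((A * S) l c) * X ^ (l : ℕ)) =
      ∑ a : Fin n, (∑ l : Fin N, C (A l a) * X ^ (l : ℕ)) * C (S a c) := by
  simp only [Matrix.mul_apply, map_sum, map_mul, Finset.sum_mul]
  rw [Finset.sum_comm]
  refine Finset.sum_congr rfl fun a _ => Finset.sum_congr rfl fun l _ => ?_
  ring

/-- Entries of `Z * A` for the lower shift `Z`: row `i` of `Z * A` is row `i - 1` of `A`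
(and row `0` vanishes). -/
private theorem relvis_shift_mul_apply {N n : ℕ} (Z : Matrix (Fin N) (Fin N) ℂ)
    (hZ : ∀ i j, Z i j = if (i : ℕ) = (j : ℕ) + 1 then 1 else 0)
    (A : Matrix (Fin N) (Fin n) ℂ) (i : Fin N) (c : Fin n) :
    (Z * A) i c = if h : 0 < (i : ℕ) then A ⟨(i : ℕ) - 1, by omega⟩ c else 0 := by
  rw [Matrix.mul_apply]
  split_ifs with h
  · rw [Finset.sum_eq_single ⟨(i : ℕ) - 1, by omega⟩]
    · rw [hZ, if_pos (by simp; omega), one_mul]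
    · intro l _ hl
      rw [hZ, if_neg, zero_mul]
      intro h'
      apply hl
      ext
      simp
      omega
    · intro h'; exact absurd (Finset.mem_univ _) h'
  · refine Finset.sum_eq_zero fun l _ => ?_
    rw [hZ, if_neg (by omega), zero_mul]

/-- Multiplication by the shift is multiplication by `X` modulo `X ^ N`:
`vp (Z * A) ≡ X * vp A (mod X^N)`. -/
private theorem relvis_vp_shift_mul {N n : ℕ} (Z : Matrix (Fin N) (Fin N) ℂ)
    (hZ : ∀ i j, Z i j = if (i : ℕ) = (j : ℕ) + 1 then 1 else 0)
    (A : Matrix (Fin N) (Fin n) ℂ) (c : Fin n) :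
    (X : ℂ[X]) ^ N ∣ (∑ l : Fin N, C ((Z * A) l c) * X ^ (l : ℕ)) -
      X * (∑ l : Fin N, C (A l c) * X ^ (l : ℕ)) := by
  rw [X_pow_dvd_iff]
  intro m hm
  rw [coeff_sub, sub_eq_zero]
  have h1 := relvis_coeff_vp (Z * A) c ⟨m, hm⟩
  simp only at h1
  rw [h1, relvis_shift_mul_apply Z hZ A]
  rcases m with _ | m
  · simp
  · rw [coeff_X_mul, dif_pos (by simp)]
    have h2 := relvis_coeff_vp A c ⟨m, by omega⟩
    simp only at h2
    rw [h2]
    rfl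

/-- Iterate: `vp (Z ^ k * A) ≡ X ^ k * vp A (mod X^N)`. -/
private theorem relvis_vp_shift_pow_mul {N n : ℕ} (Z : Matrix (Fin N) (Fin N) ℂ)
    (hZ : ∀ i j, Z i j = if (i : ℕ) = (j : ℕ) + 1 then 1 else 0)
    (A : Matrix (Fin N) (Fin n) ℂ) (c : Fin n) (k : ℕ) :
    (X : ℂ[X]) ^ N ∣ (∑ l : Fin N, C ((Z ^ k * A) l c) * X ^ (l : ℕ)) -
      X ^ k * (∑ l : Fin N, C (A l c) * X ^ (l : ℕ)) := by
  induction k with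
  | zero => simp
  | succ k ih =>
    have h1 := relvis_vp_shift_mul Z hZ (Z ^ k * A) c
    have h2 := (ih.mul_left X).add h1
    rw [pow_succ', Matrix.mul_assoc]
    convert h2 using 1
    ring

/-- Stein telescoping: if `M - Z M Zᵀ = D` then `M = ∑_{k<n} Z^k D (Zᵀ)^k + Z^n M (Zᵀ)^n`. -/
private theorem relvis_stein_telescope {N : ℕ} (Z M D : Matrix (Fin N) (Fin N) ℂ)
    (h : M - Z * M * Zᵀ = D) (n : ℕ) :
    M = (∑ k ∈ Finset.range n, Z ^ k * D * Zᵀ ^ k) + Z ^ n * M * Zᵀ ^ n := by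
  induction n with
  | zero => simp
  | succ n ih =>
    have hM : M = D + Z * M * Zᵀ := by rw [← h]; abel
    have step : Z ^ n * M * Zᵀ ^ n =
        Z ^ n * D * Zᵀ ^ n + Z ^ (n + 1) * M * Zᵀ ^ (n + 1) := by
      conv_lhs => rw [hM]
      rw [pow_succ, pow_succ']
      simp only [Matrix.mul_add, Matrix.add_mul, Matrix.mul_assoc]
    rw [Finset.sum_range_succ, add_assoc, ← step]
    exact ih

/-- Corner per coefficient: testing the corner identity on `X = single a b 1` gives
`T a b * E = F * single a b 1`. -/
private theorem relvis_corner_single {r N : ℕ} (T : Fin r → Fin r → Matrix (Fin N) (Fin N) ℂ)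
    (E F : Matrix (Fin N) (Fin r) ℂ)
    (hcorner : ∀ X : Matrix (Fin r) (Fin r) ℂ,
      (∑ a : Fin r, ∑ b : Fin r, X a b • T a b) * E = F * X)
    (a b : Fin r) :
    T a b * E = F * Matrix.single a b (1 : ℂ) := by
  have h := hcorner (Matrix.single a b 1)
  have hs : (∑ a' : Fin r, ∑ b' : Fin r, Matrix.single a b (1 : ℂ) a' b' • T a' b') = T a b := by
    simp [Matrix.single_apply, ite_and, ite_smul, Finset.sum_ite_eq]
  rw [hs] at h
  exact h

/-- Over `ℂ[X]`, an `r × d` by `d × r` product with `d < r` has zero determinant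
(evaluate at every point of the infinite field `ℂ`; the evaluated product has rank `≤ d < r`). -/
private theorem relvis_det_mul_eq_zero_of_lt {r d : ℕ} (hdr : d < r)
    (Γ : Matrix (Fin r) (Fin d) ℂ[X]) (Ψ : Matrix (Fin d) (Fin r) ℂ[X]) : (Γ * Ψ).det = 0 := by
  refine Polynomial.funext fun z => ?_
  rw [eval_zero, ← coe_evalRingHom, RingHom.map_det, RingHom.mapMatrix_apply, Matrix.map_mul]
  by_contra hne
  have hU : IsUnit (Γ.map (evalRingHom z) * Ψ.map (evalRingHom z)) :=
    (Matrix.isUnit_iff_isUnit_det _).mpr (isUnit_iff_ne_zero.mpr hne)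
  have h1 := Matrix.rank_of_isUnit _ hU
  have h2 := (Matrix.rank_mul_le_left (Γ.map (evalRingHom z)) (Ψ.map (evalRingHom z))).trans
    (Matrix.rank_le_width _)
  rw [Fintype.card_fin] at h1
  omega

/-- Key congruence (relative version).  For fixed `a b c₁` and `c ≤ N`, modulo `X ^ c`,
`∑ j vp(col j of G a b) * Ψ j c₁ ≡ [b = c₁] · vp(col a of F)`, where
`Ψ j c₁ = ∑_{k<N} X^k C ((H₀ᵀ (Zᵀ)^k E) j c₁)`: the `G₀`-part of the displacement does not
contribute modulo `X ^ c` because the first `c` rows of `G₀` vanish. -/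
private theorem relvis_key_congr {r N p q c : ℕ} (hcN : c ≤ N) (Z : Matrix (Fin N) (Fin N) ℂ)
    (hZ : ∀ i j, Z i j = if (i : ℕ) = (j : ℕ) + 1 then 1 else 0)
    (T : Fin r → Fin r → Matrix (Fin N) (Fin N) ℂ) (E F : Matrix (Fin N) (Fin r) ℂ)
    (G₀ : Matrix (Fin N) (Fin p) ℂ) (H₀ : Matrix (Fin N) (Fin q) ℂ)
    (H₁ : Fin r → Fin r → Matrix (Fin N) (Fin p) ℂ) (G : Fin r → Fin r → Matrix (Fin N) (Fin q) ℂ)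
    (hG₀ : ∀ i : Fin N, (i : ℕ) < c → ∀ k, G₀ i k = 0)
    (hcorner : ∀ X : Matrix (Fin r) (Fin r) ℂ,
      (∑ a : Fin r, ∑ b : Fin r, X a b • T a b) * E = F * X)
    (hdisp : ∀ a b, T a b - Z * T a b * Zᵀ = G₀ * (H₁ a b)ᵀ + G a b * H₀ᵀ) (a b c₁ : Fin r) :
    (X : ℂ[X]) ^ c ∣ (∑ j : Fin q, (∑ l : Fin N, C (G a b l j) * X ^ (l : ℕ)) *
        (∑ k ∈ Finset.range N, X ^ k * C ((H₀ᵀ * Zᵀ ^ k * E) j c₁))) -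
      (if b = c₁ then ∑ l : Fin N, C (F l a) * X ^ (l : ℕ) else 0) := by
  rw [← Ideal.mem_span_singleton, ← Ideal.Quotient.eq]
  set π := Ideal.Quotient.mk (Ideal.span {(X : ℂ[X]) ^ c}) with hπdef
  have hcN' : (X : ℂ[X]) ^ c ∣ X ^ N := pow_dvd_pow X hcN
  have hπk : ∀ {n : ℕ} (A : Matrix (Fin N) (Fin n) ℂ) (c₂ : Fin n) (k : ℕ),
      π (∑ l : Fin N, C ((Z ^ k * A) l c₂) * X ^ (l : ℕ)) =
        π (X ^ k * ∑ l : Fin N, C (A l c₂) * X ^ (l : ℕ)) := by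
    intro n A c₂ k
    rw [Ideal.Quotient.eq, Ideal.mem_span_singleton]
    exact hcN'.trans (relvis_vp_shift_pow_mul Z hZ A c₂ k)
  have hπN : π (X ^ N) = 0 :=
    Ideal.Quotient.eq_zero_iff_mem.mpr (Ideal.mem_span_singleton.mpr hcN')
  have hπG₀ : ∀ {n : ℕ} (S : Matrix (Fin p) (Fin n) ℂ) (c₂ : Fin n),
      π (∑ l : Fin N, C ((G₀ * S) l c₂) * X ^ (l : ℕ)) = 0 := by
    intro n S c₂
    rw [relvis_vp_mul, map_sum]
    refine Finset.sum_eq_zero fun k _ => ?_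
    rw [map_mul, Ideal.Quotient.eq_zero_iff_mem.mpr
      (Ideal.mem_span_singleton.mpr (relvis_vp_dvd_of_rows G₀ hG₀ k)), zero_mul]
  have hTE : T a b * E = (∑ k ∈ Finset.range N, Z ^ k * (G₀ * ((H₁ a b)ᵀ * Zᵀ ^ k * E))) +
      (∑ k ∈ Finset.range N, Z ^ k * (G a b * (H₀ᵀ * Zᵀ ^ k * E))) +
      Z ^ N * (T a b * Zᵀ ^ N * E) := by
    conv_lhs => rw [relvis_stein_telescope Z (T a b) _ (hdisp a b) N]
    simp only [Matrix.add_mul, Matrix.mul_add, Matrix.sum_mul, Matrix.mul_assoc,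
      Finset.sum_add_distrib]
  have h1 : (∑ l : Fin N, C ((T a b * E) l c₁) * X ^ (l : ℕ)) =
      if b = c₁ then ∑ l : Fin N, C (F l a) * X ^ (l : ℕ) else 0 := by
    rw [relvis_corner_single T E F hcorner a b, relvis_vp_mul]
    simp only [Matrix.single_apply]
    rw [Finset.sum_eq_single a]
    · by_cases hbc : b = c₁ <;> simp [hbc]
    · intro a' _ ha'
      simp [Ne.symm ha']
    · intro h; exact absurd (Finset.mem_univ a) h
  have h2 : (∑ l : Fin N, C ((T a b * E) l c₁) * X ^ (l : ℕ)) =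
      (∑ k ∈ Finset.range N, ∑ l : Fin N,
        C ((Z ^ k * (G₀ * ((H₁ a b)ᵀ * Zᵀ ^ k * E))) l c₁) * X ^ (l : ℕ)) +
      (∑ k ∈ Finset.range N, ∑ l : Fin N,
        C ((Z ^ k * (G a b * (H₀ᵀ * Zᵀ ^ k * E))) l c₁) * X ^ (l : ℕ)) +
      ∑ l : Fin N, C ((Z ^ N * (T a b * Zᵀ ^ N * E)) l c₁) * X ^ (l : ℕ) := by
    rw [hTE]
    simp only [Matrix.add_apply, Matrix.sum_apply, map_add, map_sum, add_mul, Finset.sum_mul,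
      Finset.sum_add_distrib]
    congr 2 <;> exact Finset.sum_comm
  have hP₀ : π (∑ k ∈ Finset.range N, ∑ l : Fin N,
      C ((Z ^ k * (G₀ * ((H₁ a b)ᵀ * Zᵀ ^ k * E))) l c₁) * X ^ (l : ℕ)) = 0 := by
    rw [map_sum]
    refine Finset.sum_eq_zero fun k _ => ?_
    rw [hπk, map_mul, hπG₀, mul_zero]
  have h3 : (∑ j : Fin q, (∑ l : Fin N, C (G a b l j) * X ^ (l : ℕ)) *
        (∑ k ∈ Finset.range N, X ^ k * C ((H₀ᵀ * Zᵀ ^ k * E) j c₁))) =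
      ∑ k ∈ Finset.range N, X ^ k *
        ∑ l : Fin N, C ((G a b * (H₀ᵀ * Zᵀ ^ k * E)) l c₁) * X ^ (l : ℕ) := by
    simp_rw [relvis_vp_mul]
    simp only [Finset.mul_sum]
    rw [Finset.sum_comm]
    refine Finset.sum_congr rfl fun k _ => Finset.sum_congr rfl fun j _ => ?_
    ring
  rw [← h1, h2, h3, map_add, map_add, hP₀, zero_add, map_sum, map_sum, hπk _ _ N, map_mul, hπN,
    zero_mul, add_zero]
  exact Finset.sum_congr rfl fun k _ => (hπk _ _ k).symm

/-- The relative H-const lemma for an explicit shift matrix `Z` and a cut `c ≤ N`, with the visible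
target entry `F i₀ a ≠ 0`, `i₀ < c`, already chosen. -/
private theorem relvis_bound_of_le {r N p q c : ℕ} (hcN : c ≤ N) (Z : Matrix (Fin N) (Fin N) ℂ)
    (hZ : ∀ i j, Z i j = if (i : ℕ) = (j : ℕ) + 1 then 1 else 0)
    (T : Fin r → Fin r → Matrix (Fin N) (Fin N) ℂ) (E F : Matrix (Fin N) (Fin r) ℂ)
    (G₀ : Matrix (Fin N) (Fin p) ℂ) (H₀ : Matrix (Fin N) (Fin q) ℂ)
    (H₁ : Fin r → Fin r → Matrix (Fin N) (Fin p) ℂ) (G : Fin r → Fin r → Matrix (Fin N) (Fin q) ℂ)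
    (hG₀ : ∀ i : Fin N, (i : ℕ) < c → ∀ k, G₀ i k = 0)
    (a : Fin r) (i₀ : Fin N) (hi₀ : (i₀ : ℕ) < c) (ha : F i₀ a ≠ 0)
    (hcorner : ∀ X : Matrix (Fin r) (Fin r) ℂ,
      (∑ a : Fin r, ∑ b : Fin r, X a b • T a b) * E = F * X)
    (hdisp : ∀ a b, T a b - Z * T a b * Zᵀ = G₀ * (H₁ a b)ᵀ + G a b * H₀ᵀ) : r ≤ q := by
  by_contra hlt
  push Not at hlt
  -- polynomial data attached to the row index `a`
  set φ : ℂ[X] := ∑ l : Fin N, C (F l a) * X ^ (l : ℕ) with hφdef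
  set Γ : Matrix (Fin r) (Fin q) ℂ[X] :=
    Matrix.of fun b j => ∑ l : Fin N, C (G a b l j) * X ^ (l : ℕ) with hΓdef
  set Ψ : Matrix (Fin q) (Fin r) ℂ[X] :=
    Matrix.of fun j c₁ => ∑ k ∈ Finset.range N, X ^ k * C ((H₀ᵀ * Zᵀ ^ k * E) j c₁) with hΨdef
  have hkey : ∀ b c₁, ∃ y : ℂ[X], (Γ * Ψ) b c₁ - (if b = c₁ then φ else 0) = X ^ c * y := by
    intro b c₁
    obtain ⟨y, hy⟩ := relvis_key_congr hcN Z hZ T E F G₀ H₀ H₁ G hG₀ hcorner hdisp a b c₁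
    exact ⟨y, by rw [← hy, Matrix.mul_apply]; rfl⟩
  choose Y hY using hkey
  -- `φ ≠ 0` and its factorisation `φ = X ^ m * u` with `u.coeff 0 ≠ 0` and `m < c`
  have hφ0 : φ ≠ 0 := by
    intro h
    apply ha
    have := relvis_coeff_vp F a i₀
    rw [← hφdef, h, coeff_zero] at this
    exact this.symm
  obtain ⟨u, hu, hXu⟩ := exists_eq_pow_rootMultiplicity_mul_and_not_dvd φ hφ0 0
  rw [map_zero, sub_zero] at hu hXu
  rw [X_dvd_iff] at hXu
  set m := rootMultiplicity 0 φ with hmdef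
  have hmc : m < c := by
    by_contra hle
    push Not at hle
    apply ha
    have hdvd : (X : ℂ[X]) ^ c ∣ φ := (pow_dvd_pow X hle).trans ⟨u, hu⟩
    have h0 := (X_pow_dvd_iff.mp hdvd) i₀ hi₀
    rw [hφdef, relvis_coeff_vp F a i₀] at h0
    exact h0
  have hXc : (X : ℂ[X]) ^ c = X ^ m * X ^ (c - m) := by
    rw [← pow_add, Nat.add_sub_cancel' hmc.le]
  -- factor the product matrix: `Γ * Ψ = X ^ m • (u • 1 + X ^ (c - m) • Y)`
  have hprod : Γ * Ψ = (X : ℂ[X]) ^ m •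
      Matrix.of (fun b c₁ => (if b = c₁ then u else 0) + X ^ (c - m) * Y b c₁) := by
    ext b c₁
    have e := hY b c₁
    rw [sub_eq_iff_eq_add] at e
    rw [e, Matrix.smul_apply, Matrix.of_apply, smul_eq_mul, hXc]
    split_ifs with hbc
    · rw [hu]; ring_nf
    · ring_nf
  -- determinants: `det (Γ * Ψ) = 0`, but the right-hand side has nonzero determinant
  have hdet := relvis_det_mul_eq_zero_of_lt hlt Γ Ψ
  rw [hprod, Matrix.det_smul, Fintype.card_fin, mul_eq_zero] at hdet
  rcases hdet with h | h
  · exact (pow_ne_zero _ (pow_ne_zero _ X_ne_zero)) h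
  · have h' := congrArg (eval 0) h
    rw [eval_zero, ← coe_evalRingHom, RingHom.map_det, RingHom.mapMatrix_apply] at h'
    have hmap : (Matrix.of fun b c₁ => (if b = c₁ then u else 0) + X ^ (c - m) * Y b c₁).map
        (evalRingHom 0) = Matrix.diagonal fun _ => eval 0 u := by
      ext b c₁
      simp only [Matrix.map_apply, Matrix.of_apply, coe_evalRingHom, eval_add, eval_mul, eval_pow,
        eval_X, Matrix.diagonal_apply]
      rw [zero_pow (Nat.sub_ne_zero_of_lt hmc), zero_mul, add_zero]
      split_ifs <;> simp
    rw [hmap, Matrix.det_diagonal, Finset.prod_const, Finset.card_univ, Fintype.card_fin] at h'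
    apply hXu
    rw [coeff_zero_eq_eval_zero]
    exact (pow_eq_zero_iff (by omega)).mp h'

/-- Relative H-const lemma ("a visible target forces r ≤ q"). Mixed compression class: every
coefficient matrix has Stein displacement `T a b − Z (T a b) Zᵀ = G₀ * (H₁ a b)ᵀ + G a b * H₀ᵀ` with a
CONSTANT left factor `G₀ : N × p` whose first `c` rows vanish and a CONSTANT right factor
`H₀ : N × q`.  If the pencil hides a linearly explained corner `T(X) E = F X` and some entry of `F`
in the first `c` rows is nonzero (a target direction visible above the G-cut), then `r ≤ q`.
(`p` plays no role in the bound; `c = N`, `p = 0` is the H-const lemma `hclR_hconst_bound`.) -/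
theorem hclR_relvis_bound (r N p q c : ℕ) (T : Fin r → Fin r → Matrix (Fin N) (Fin N) ℂ)
    (E F : Matrix (Fin N) (Fin r) ℂ) (G₀ : Matrix (Fin N) (Fin p) ℂ) (H₀ : Matrix (Fin N) (Fin q) ℂ)
    (H₁ : Fin r → Fin r → Matrix (Fin N) (Fin p) ℂ) (G : Fin r → Fin r → Matrix (Fin N) (Fin q) ℂ)
    (hG₀ : ∀ i : Fin N, (i : ℕ) < c → ∀ k, G₀ i k = 0)
    (hvis : ∃ (a : Fin r) (i : Fin N), (i : ℕ) < c ∧ F i a ≠ 0)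
    (hcorner : ∀ X : Matrix (Fin r) (Fin r) ℂ, (∑ a : Fin r, ∑ b : Fin r, X a b • T a b) * E = F * X)
    (hdisp : ∀ a b, T a b - (Matrix.of fun i j : Fin N => if (i : ℕ) = (j : ℕ) + 1 then (1 : ℂ) else 0) * T a b *
        (Matrix.of fun i j : Fin N => if (i : ℕ) = (j : ℕ) + 1 then (1 : ℂ) else 0)ᵀ
        = G₀ * (H₁ a b)ᵀ + G a b * H₀ᵀ) :
    r ≤ q := by
  set Z : Matrix (Fin N) (Fin N) ℂ :=
    Matrix.of fun i j : Fin N => if (i : ℕ) = (j : ℕ) + 1 then (1 : ℂ) else 0 with hZdef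
  have hZ : ∀ i j, Z i j = if (i : ℕ) = (j : ℕ) + 1 then (1 : ℂ) else 0 := fun i j => rfl
  obtain ⟨a, i₀, hi₀, ha⟩ := hvis
  exact relvis_bound_of_le (min_le_right c N) Z hZ T E F G₀ H₀ H₁ G
    (fun i hi k => hG₀ i (lt_of_lt_of_le hi (min_le_left c N)) k) a i₀ (lt_min hi₀ i₀.is_lt) ha
    hcorner hdisp

end Summit.MatrixMultiplication.MatrixMultiplication.Theorems
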